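import Summits.CriticalPhenomena.PercolationContinuityZ3.Theorems.PercNearOneGluingNoHeavyLowerTailCoinStep
import Summits.CriticalPhenomena.PercolationContinuityZ3.Theorems.PercNearOneGluingNoHeavyLowerTailMergeStability
import HarnessLib

/-!
# `NoHeavyLowerTail` (stmt-CriticalPhenomena-4575) — THE COIN REDUCTION of the pattern-lightest bound

Support file (prover `prim-hp-8`, PL programme; `--supports stmt-CriticalPhenomena-4575`).  No definitions, no named facts,
no sorries.  Notation of `…CoinPatterns.lean` / `…CoinStep.lean`: observer `o ∉ A`, pattern `π⁰`, ranking `r` injective on `A` and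
compatible with lightness in `H` (the weights with the pairs at `o` switched off), selection events `Sel_b`, and
`Φ_r(v) = Σ_{b∈A} μ_v(Sel_b)·μ_v(R_b) − μ_v(1 ≤ N ≤ j)` (so `Φ_r(v) ≥ 0` is the pattern-lightest bound with selection `r`, which
implies the cumulative isolation lemma `stub_cumulativeIsolation` at `o` by `PatternLightest.le_champion_of_patternBound`).

* `coinReduction` — for every set `C ⊆ A` of coins:  `Φ_r(v) ≥ (Π_{c∈C} (1 − v s(o,c))) · Φ_r(v_C)`, where `v_C` switches off the
  pairs `o–c`, `c ∈ C` (iteration of `CoinReduction.coinStep`; `H` and hence the ranking hypothesis never change).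
* `patternLightest_of_coinfree` — WLOG COIN-FREE: if the pattern-lightest bound (selection `r`) holds for the observer with ALL
  its relay pairs switched off, it holds for the observer itself.
* `patternLightest_sel_of_relayNeighbours` — it holds outright when every positive-weight non-loop pair at `o` goes to a relay
  (then the coin-free observer is isolated and both sides vanish): the pattern/selection form of
  `PatternLightestStar.patternLightest_firstPort`, for EVERY `H`-compatible ranking.

What is NOT here: observers with ≥ 2 free neighbours (the open case; by the two-copy expansion it is equivalent to the symmetric
two-set inequality "Conjecture S" of the memo PROOF-COIN-REDUCTION.md §7, censused 0 / 15 650 but unproved).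
-/

noncomputable section

namespace Summit.CriticalPhenomena.PercolationContinuityZ3.Theorems

namespace CoinReduction

open MeasureTheory Set Literature.Probability.LatticeModels Literature.Probability.Percolation
open scoped Classical BigOperators

variable {n : ℕ}

/-- Switching off the pairs `o–c`, `c ∈ C`, does not change the restricted weights `H`. [folklore] -/
theorem restrict_switchOff_eq (v : Sym2 (Fin n) → unitInterval) (o : Fin n) (C : Finset (Fin n)) :
    (fun e : Sym2 (Fin n) => if e ∈ {e : Sym2 (Fin n) | o ∉ e} then
        (fun e' : Sym2 (Fin n) => if ∃ c ∈ C, e' = s(o, c) then (0 : unitInterval) else v e') e else 0) =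
      fun e : Sym2 (Fin n) => if e ∈ {e : Sym2 (Fin n) | o ∉ e} then v e else 0 := by
  funext e
  by_cases he : e ∈ {e : Sym2 (Fin n) | o ∉ e}
  · have hne : ¬ ∃ c ∈ C, e = s(o, c) := by
      rintro ⟨c, _, rfl⟩
      exact he (Sym2.mem_mk_left o c)
    simp only [he, if_true, hne, if_false]
  · simp only [he, if_false]

/-- **The coin reduction.**  `o ∉ A`, `r` injective on `A` and compatible with lightness in `H`, `C ⊆ A`.  Then
`(Π_{c∈C} (1 − v s(o,c))) · Φ_r(v_C) ≤ Φ_r(v)`, where `v_C e = 0` if `e = s(o,c)` for some `c ∈ C` and `v_C e = v e` otherwise.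
[folklore — iteration of `coinStep`] -/
theorem coinReduction (v : Sym2 (Fin n) → unitInterval) (A : Finset (Fin n)) (j : ℕ) (o : Fin n)
    (r : Fin n → ℕ) (hr : Set.InjOn r ↑A) (hoA : o ∉ A)
    (hcompat : ∀ b ∈ A, ∀ b' ∈ A, r b < r b' →
      (prodBernoulli fun e : Sym2 (Fin n) => if e ∈ {e : Sym2 (Fin n) | o ∉ e} then v e else 0).real
          {ω : BondConfig (Fin n) | (A.filter fun z => ω ∈ openConn b' z).card ≤ j} ≤
        (prodBernoulli fun e : Sym2 (Fin n) => if e ∈ {e : Sym2 (Fin n) | o ∉ e} then v e else 0).real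
          {ω : BondConfig (Fin n) | (A.filter fun z => ω ∈ openConn b z).card ≤ j})
    (C : Finset (Fin n)) (hCA : C ⊆ A) :
    (∏ c ∈ C, (1 - (v s(o, c) : ℝ))) *
        (∑ b ∈ A, (prodBernoulli fun e : Sym2 (Fin n) => if ∃ c ∈ C, e = s(o, c) then 0 else v e).real
            {ω : BondConfig (Fin n) |
              b ∈ (A.filter fun b' => ω ∈ openConnIn ((↑A : Set (Fin n))ᶜ ∪ {b'}) o b') ∧
              ∀ b' ∈ A, r b' < r b → b' ∉ (A.filter fun b'' => ω ∈ openConnIn ((↑A : Set (Fin n))ᶜ ∪ {b''}) o b'')} *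
          (prodBernoulli fun e : Sym2 (Fin n) => if ∃ c ∈ C, e = s(o, c) then 0 else v e).real
            {ω : BondConfig (Fin n) | (A.filter fun z => ω ∈ openConn b z).card ≤ j} -
        (prodBernoulli fun e : Sym2 (Fin n) => if ∃ c ∈ C, e = s(o, c) then 0 else v e).real
          {ω : BondConfig (Fin n) | 1 ≤ (A.filter fun z => ω ∈ openConn o z).card ∧
            (A.filter fun z => ω ∈ openConn o z).card ≤ j}) ≤
      ∑ b ∈ A, (prodBernoulli v).real {ω : BondConfig (Fin n) |
          b ∈ (A.filter fun b' => ω ∈ openConnIn ((↑A : Set (Fin n))ᶜ ∪ {b'}) o b') ∧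
          ∀ b' ∈ A, r b' < r b → b' ∉ (A.filter fun b'' => ω ∈ openConnIn ((↑A : Set (Fin n))ᶜ ∪ {b''}) o b'')} *
        (prodBernoulli v).real {ω : BondConfig (Fin n) | (A.filter fun z => ω ∈ openConn b z).card ≤ j} -
      (prodBernoulli v).real {ω : BondConfig (Fin n) | 1 ≤ (A.filter fun z => ω ∈ openConn o z).card ∧
        (A.filter fun z => ω ∈ openConn o z).card ≤ j} := by
  -- the functional, as a function of the weights
  set pat : BondConfig (Fin n) → Finset (Fin n) :=
    fun ω => A.filter fun b' => ω ∈ openConnIn ((↑A : Set (Fin n))ᶜ ∪ {b'}) o b' with hpat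
  set Sel : Fin n → Set (BondConfig (Fin n)) := fun b => {ω | b ∈ pat ω ∧ ∀ b' ∈ A, r b' < r b → b' ∉ pat ω} with hSel
  set R : Fin n → Set (BondConfig (Fin n)) := fun b => {ω | (A.filter fun z => ω ∈ openConn b z).card ≤ j} with hR
  set L : Set (BondConfig (Fin n)) := {ω | 1 ≤ (A.filter fun z => ω ∈ openConn o z).card ∧
    (A.filter fun z => ω ∈ openConn o z).card ≤ j} with hL
  set Φ : (Sym2 (Fin n) → unitInterval) → ℝ :=
    fun w => ∑ b ∈ A, (prodBernoulli w).real (Sel b) * (prodBernoulli w).real (R b) - (prodBernoulli w).real L with hΦ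
  -- the statement, generalised over the weights (the hypothesis only depends on the restricted weights)
  suffices H : ∀ (C : Finset (Fin n)), C ⊆ A → ∀ (w : Sym2 (Fin n) → unitInterval),
      (fun e : Sym2 (Fin n) => if e ∈ {e : Sym2 (Fin n) | o ∉ e} then w e else 0) =
        (fun e : Sym2 (Fin n) => if e ∈ {e : Sym2 (Fin n) | o ∉ e} then v e else 0) →
      (∏ c ∈ C, (1 - (w s(o, c) : ℝ))) * Φ (fun e => if ∃ c ∈ C, e = s(o, c) then 0 else w e) ≤ Φ w from
    H C hCA v rfl
  intro C
  induction C using Finset.induction_on with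
  | empty =>
    intro _ w _
    have hw : (fun e : Sym2 (Fin n) => if ∃ c ∈ (∅ : Finset (Fin n)), e = s(o, c) then (0 : unitInterval) else w e) = w := by
      funext e; simp
    rw [hw, Finset.prod_empty, one_mul]
  | insert c C' hcC' ih =>
    intro hCA w hw
    have hcA : c ∈ A := hCA (Finset.mem_insert_self c C')
    have hC'A : C' ⊆ A := fun x hx => hCA (Finset.mem_insert_of_mem hx)
    -- the one-coin step for w at the coin c
    have hcompat_w : ∀ b ∈ A, ∀ b' ∈ A, r b < r b' →
        (prodBernoulli fun e : Sym2 (Fin n) => if e ∈ {e : Sym2 (Fin n) | o ∉ e} then w e else 0).real (R b') ≤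
          (prodBernoulli fun e : Sym2 (Fin n) => if e ∈ {e : Sym2 (Fin n) | o ∉ e} then w e else 0).real (R b) := by
      rw [hw]; exact hcompat
    have hstep : (1 - (w s(o, c) : ℝ)) * Φ (Function.update w s(o, c) 0) ≤ Φ w :=
      coinStep w A j r hr hoA hcA hcompat_w
    -- the induction hypothesis for w' = w[oc ↦ 0]
    set w' := Function.update w s(o, c) 0 with hw'
    have hw'res : (fun e : Sym2 (Fin n) => if e ∈ {e : Sym2 (Fin n) | o ∉ e} then w' e else 0) =
        fun e : Sym2 (Fin n) => if e ∈ {e : Sym2 (Fin n) | o ∉ e} then v e else 0 := by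
      rw [hw', restrict_update_eq, hw]
    have hih := ih hC'A w' hw'res
    -- identify the switched-off weights
    have hsw : (fun e : Sym2 (Fin n) => if ∃ c' ∈ C', e = s(o, c') then (0 : unitInterval) else w' e) =
        fun e : Sym2 (Fin n) => if ∃ c' ∈ insert c C', e = s(o, c') then (0 : unitInterval) else w e := by
      funext e
      by_cases h1 : ∃ c' ∈ C', e = s(o, c')
      · have h2 : ∃ c' ∈ insert c C', e = s(o, c') := by
          obtain ⟨c', hc', he⟩ := h1; exact ⟨c', Finset.mem_insert_of_mem hc', he⟩
        rw [if_pos h1, if_pos h2]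
      · rw [if_neg h1]
        by_cases hec : e = s(o, c)
        · have h2 : ∃ c' ∈ insert c C', e = s(o, c') := ⟨c, Finset.mem_insert_self c C', hec⟩
          rw [if_pos h2, hec, hw', Function.update_self]
        · have h2 : ¬ ∃ c' ∈ insert c C', e = s(o, c') := by
            rintro ⟨c', hc', he⟩
            rcases Finset.mem_insert.1 hc' with h | h
            · exact hec (h ▸ he)
            · exact h1 ⟨c', h, he⟩
          rw [if_neg h2, hw', Function.update_of_ne hec]
    have hprod : ∏ c' ∈ C', (1 - (w' s(o, c') : ℝ)) = ∏ c' ∈ C', (1 - (w s(o, c') : ℝ)) := by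
      apply Finset.prod_congr rfl
      intro c' hc'
      have hne : s(o, c') ≠ s(o, c) := by
        intro h
        have : c' = c := by
          rcases Sym2.eq_iff.1 h with ⟨_, h2⟩ | ⟨h1, h2⟩
          · exact h2
          · exact h2.trans h1
        exact hcC' (this ▸ hc')
      rw [hw', Function.update_of_ne hne]
    rw [hsw, hprod] at hih
    have h1c : 0 ≤ 1 - (w s(o, c) : ℝ) := sub_nonneg.2 (w s(o, c)).2.2
    rw [Finset.prod_insert hcC']
    calc (1 - (w s(o, c) : ℝ)) * (∏ c' ∈ C', (1 - (w s(o, c') : ℝ))) *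
          Φ (fun e => if ∃ c' ∈ insert c C', e = s(o, c') then 0 else w e)
        = (1 - (w s(o, c) : ℝ)) * ((∏ c' ∈ C', (1 - (w s(o, c') : ℝ))) *
          Φ (fun e => if ∃ c' ∈ insert c C', e = s(o, c') then 0 else w e)) := by ring
      _ ≤ (1 - (w s(o, c) : ℝ)) * Φ w' := mul_le_mul_of_nonneg_left hih h1c
      _ ≤ Φ w := hstep

/-- **WLOG coin-free.**  If the pattern-lightest bound with selection `r` holds for the observer with ALL its relay pairs switched
off (`v_A`), then it holds for the observer itself:  `μ_v(1 ≤ N ≤ j) ≤ Σ_{b∈A} μ_v(Sel_b)·μ_v(R_b)`.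
[folklore — `coinReduction` with `C = A`] -/
theorem patternLightest_of_coinfree (v : Sym2 (Fin n) → unitInterval) (A : Finset (Fin n)) (j : ℕ) (o : Fin n)
    (r : Fin n → ℕ) (hr : Set.InjOn r ↑A) (hoA : o ∉ A)
    (hcompat : ∀ b ∈ A, ∀ b' ∈ A, r b < r b' →
      (prodBernoulli fun e : Sym2 (Fin n) => if e ∈ {e : Sym2 (Fin n) | o ∉ e} then v e else 0).real
          {ω : BondConfig (Fin n) | (A.filter fun z => ω ∈ openConn b' z).card ≤ j} ≤
        (prodBernoulli fun e : Sym2 (Fin n) => if e ∈ {e : Sym2 (Fin n) | o ∉ e} then v e else 0).real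
          {ω : BondConfig (Fin n) | (A.filter fun z => ω ∈ openConn b z).card ≤ j})
    (hcf : (prodBernoulli fun e : Sym2 (Fin n) => if ∃ c ∈ A, e = s(o, c) then 0 else v e).real
          {ω : BondConfig (Fin n) | 1 ≤ (A.filter fun z => ω ∈ openConn o z).card ∧
            (A.filter fun z => ω ∈ openConn o z).card ≤ j} ≤
        ∑ b ∈ A, (prodBernoulli fun e : Sym2 (Fin n) => if ∃ c ∈ A, e = s(o, c) then 0 else v e).real
            {ω : BondConfig (Fin n) |
              b ∈ (A.filter fun b' => ω ∈ openConnIn ((↑A : Set (Fin n))ᶜ ∪ {b'}) o b') ∧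
              ∀ b' ∈ A, r b' < r b → b' ∉ (A.filter fun b'' => ω ∈ openConnIn ((↑A : Set (Fin n))ᶜ ∪ {b''}) o b'')} *
          (prodBernoulli fun e : Sym2 (Fin n) => if ∃ c ∈ A, e = s(o, c) then 0 else v e).real
            {ω : BondConfig (Fin n) | (A.filter fun z => ω ∈ openConn b z).card ≤ j}) :
    (prodBernoulli v).real {ω : BondConfig (Fin n) | 1 ≤ (A.filter fun z => ω ∈ openConn o z).card ∧
        (A.filter fun z => ω ∈ openConn o z).card ≤ j} ≤
      ∑ b ∈ A, (prodBernoulli v).real {ω : BondConfig (Fin n) |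
          b ∈ (A.filter fun b' => ω ∈ openConnIn ((↑A : Set (Fin n))ᶜ ∪ {b'}) o b') ∧
          ∀ b' ∈ A, r b' < r b → b' ∉ (A.filter fun b'' => ω ∈ openConnIn ((↑A : Set (Fin n))ᶜ ∪ {b''}) o b'')} *
        (prodBernoulli v).real {ω : BondConfig (Fin n) | (A.filter fun z => ω ∈ openConn b z).card ≤ j} := by
  have h := coinReduction v A j o r hr hoA hcompat A (subset_refl A)
  have hprod : 0 ≤ ∏ c ∈ A, (1 - (v s(o, c) : ℝ)) :=
    Finset.prod_nonneg fun c _ => sub_nonneg.2 (v s(o, c)).2.2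
  nlinarith [mul_nonneg hprod (sub_nonneg.2 hcf)]

/-- **The pattern-lightest bound (selection form) for every relay-neighboured observer.**  If `o ∉ A` and every pair `o–y` with
`y ≠ o`, `y ∉ A` has weight `0`, then for every ranking `r` injective on `A` and compatible with lightness in `H`:
`μ(1 ≤ N ≤ j) ≤ Σ_{b∈A} μ(Sel_b)·μ(R_b)` — the observer's relay block is small and nonempty no more often than the expected
lightness of the `r`-first relay it is directly attached to.  (The coin-free observer is isolated, so both sides of its bound
vanish; then `patternLightest_of_coinfree`.)  Selection form of `PatternLightestStar.patternLightest_firstPort`.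
[folklore — via the coin reduction] -/
theorem patternLightest_sel_of_relayNeighbours (v : Sym2 (Fin n) → unitInterval) (A : Finset (Fin n)) (j : ℕ) (o : Fin n)
    (r : Fin n → ℕ) (hr : Set.InjOn r ↑A) (hoA : o ∉ A)
    (hobs : ∀ y : Fin n, y ≠ o → y ∉ A → v s(o, y) = 0)
    (hcompat : ∀ b ∈ A, ∀ b' ∈ A, r b < r b' →
      (prodBernoulli fun e : Sym2 (Fin n) => if e ∈ {e : Sym2 (Fin n) | o ∉ e} then v e else 0).real
          {ω : BondConfig (Fin n) | (A.filter fun z => ω ∈ openConn b' z).card ≤ j} ≤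
        (prodBernoulli fun e : Sym2 (Fin n) => if e ∈ {e : Sym2 (Fin n) | o ∉ e} then v e else 0).real
          {ω : BondConfig (Fin n) | (A.filter fun z => ω ∈ openConn b z).card ≤ j}) :
    (prodBernoulli v).real {ω : BondConfig (Fin n) | 1 ≤ (A.filter fun z => ω ∈ openConn o z).card ∧
        (A.filter fun z => ω ∈ openConn o z).card ≤ j} ≤
      ∑ b ∈ A, (prodBernoulli v).real {ω : BondConfig (Fin n) |
          b ∈ (A.filter fun b' => ω ∈ openConnIn ((↑A : Set (Fin n))ᶜ ∪ {b'}) o b') ∧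
          ∀ b' ∈ A, r b' < r b → b' ∉ (A.filter fun b'' => ω ∈ openConnIn ((↑A : Set (Fin n))ᶜ ∪ {b''}) o b'')} *
        (prodBernoulli v).real {ω : BondConfig (Fin n) | (A.filter fun z => ω ∈ openConn b z).card ≤ j} := by
  apply patternLightest_of_coinfree v A j o r hr hoA hcompat
  set vA : Sym2 (Fin n) → unitInterval := fun e => if ∃ c ∈ A, e = s(o, c) then 0 else v e with hvA
  -- every non-loop pair at o has weight 0 in vA
  have hzero : ∀ y : Fin n, y ≠ o → (vA s(o, y) : ℝ) = 0 := by
    intro y hyo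
    simp only [hvA]
    by_cases hyA : y ∈ A
    · rw [if_pos ⟨y, hyA, rfl⟩]; rfl
    · have hne : ¬ ∃ c ∈ A, s(o, y) = s(o, c) := by
        rintro ⟨c, hcA, h⟩
        have : y = c := by
          rcases Sym2.eq_iff.1 h with ⟨_, h2⟩ | ⟨h1, h2⟩
          · exact h2
          · exact h2.trans h1
        exact hyA (this ▸ hcA)
      rw [if_neg hne, hobs y hyo hyA]; rfl
  have hL : (prodBernoulli vA).real {ω : BondConfig (Fin n) | 1 ≤ (A.filter fun z => ω ∈ openConn o z).card ∧
      (A.filter fun z => ω ∈ openConn o z).card ≤ j} = 0 :=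
    MergeStability.real_L_eq_zero_of_isolated vA A o j hoA hzero
  rw [hL]
  exact Finset.sum_nonneg fun b _ => mul_nonneg measureReal_nonneg measureReal_nonneg

end CoinReduction

end Summit.CriticalPhenomena.PercolationContinuityZ3.Theorems

end
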